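import Mathlib
import Summits.MatrixMultiplication.MatrixMultiplication.Theorems.SnSubsetDichotomyHyperoctahedralThresholdTwinSupplyCSCyclic

/-!
# Root-local self-clean census (crux `HyperoctahedralThreshold`, open core `stub_poorRigidCore`; STUB-PLAN target T2)

Conventions of the line: three involutions `μ c` of `Fin n` act on the right, `y · w := w.foldl (fun v c => μ c v) y`;
reduced words are `List.IsChain (· ≠ ·)`; `TwinSupplyCS.RW a` is the finset of reduced words of length `a`
(`|RW a| = 3 · 2^(a-1)` for `a ≥ 1`, `TwinSupplyCS.card_RW`).  A ROOT is an ordered pair `(v, x)` of points; the rungs of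
a word `β` seen from the root are `r_s := (v · β_[s], x · β_[s])`, `s ≤ a` (`β_[s] = β.take s`), and `β` is SELF-CLEAN from
`(v, x)` when any two of its rungs are equal, swapped, or disjoint (the clean format of the core's conclusion).

* `RootSelfCleanSum.card_coincidence_le` — the bijection trick: for a reduced `g` of length `a` and `s < t ≤ a` the points
  `y` with `y · g_[s] = y · g_[t]` are carried injectively by `y ↦ y · g_[s]` into the fixed points of the nonempty reduced
  word `g_(s,t]` of length `≤ a`, hence number `≤ Φ₀` under a fixed-point bound `Φ₀` for such words.
* `RootSelfCleanSum.sum_sum_card_le` — the census: a rung pair `(s, t)` that is neither equal, swapped nor disjoint is a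
  coincidence `v·β_[s] = v·β_[t]` (`s ≠ t`), or `x·β_[s] = x·β_[t]` (`s ≠ t`), or `v·β_[s] = x·β_[t]` (the fourth kind
  `x·β_[s] = v·β_[t]` is the third at `(t, s)`); over all roots the three families have `g`-fibres of size `≤ Φ₀ · n`,
  `≤ n · Φ₀`, `≤ n` (the other coordinate is free, resp. determined by the bijection `y ↦ y · g_[t]`), so the triples
  `(v, x, β)` with `β` not self-clean from `(v, x)` number at most `(a+1)² · |RW a| · 2n(Φ₀+1) = (a+1)² · n · (3·2^a) · (Φ₀+1)`.
* `stub_rootSelfCleanSum` — the registered form (Markov numerator T2 of the root-local twin census of `stub_poorRigidCore`).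

Pure finite combinatorics, no definitions; the fibre lemma and the three-family cover are adapted from the dart-level
template `…SelfCleanDarts` (`card_pp_fibre_le`, `card_selfUnclean_le`).
-/

-- the tree's namespace `Summit.MatrixMultiplication.MatrixMultiplication.…` repeats a component by design
set_option linter.dupNamespace false

namespace Summit.MatrixMultiplication.MatrixMultiplication.Theorems.HyperoctahedralThreshold

namespace RootSelfCleanSum

open Finset

variable {n : ℕ}

/-- The right action `y ↦ y · w` of a colour word by permutations is injective. -/
theorem foldl_perm_injective (μ : Fin 3 → Equiv.Perm (Fin n)) (w : List (Fin 3)) :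
    Function.Injective (fun y : Fin n => w.foldl (fun v d => μ d v) y) := by
  induction w with
  | nil => exact fun a b h => h
  | cons c w ih =>
    intro a b h
    have h' : w.foldl (fun v d => μ d v) (μ c a) = w.foldl (fun v d => μ d v) (μ c b) := h
    exact (μ c).injective (ih h')

-- adapted from Summits/.../SnSubsetDichotomyHyperoctahedralThresholdSelfCleanDarts.lean (`card_pp_fibre_le`, siege k9)
/-- **Coincidence fibre** (bijection trick).  If every nonempty reduced word of length `≤ a` has at most `Φ₀` fixed points,
then for a reduced `g` of length `a` and `s < t ≤ a` the points `y` with `y · g_[s] = y · g_[t]` number at most `Φ₀`: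
`y ↦ y · g_[s]` carries them injectively into the fixed points of the nonempty reduced word `g_(s,t]`. -/
theorem card_coincidence_le (μ : Fin 3 → Equiv.Perm (Fin n)) {a s t : ℕ} (Φ₀ : ℕ)
    (hΦ : ∀ w : List (Fin 3), w ≠ [] → List.IsChain (· ≠ ·) w → w.length ≤ a →
      ((Finset.univ : Finset (Fin n)).filter (fun y => w.foldl (fun v b => μ b v) y = y)).card ≤ Φ₀)
    (g : List (Fin 3)) (hl : g.length = a) (hg : List.IsChain (· ≠ ·) g) (hst : s < t) (hta : t ≤ a) :
    ((Finset.univ : Finset (Fin n)).filter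
      (fun y => (g.take s).foldl (fun w d => μ d w) y = (g.take t).foldl (fun w d => μ d w) y)).card ≤ Φ₀ := by
  set u := (g.take t).drop s with hu
  have hsplit : g.take t = g.take s ++ u := by
    have h := (List.take_append_drop s (g.take t)).symm
    rw [List.take_take, Nat.min_eq_left hst.le] at h
    exact h
  have hulen : u.length = t - s := by rw [hu, List.length_drop, List.length_take]; omega
  have hune : u ≠ [] := List.ne_nil_of_length_pos (by omega)
  have huc : List.IsChain (· ≠ ·) u := (hg.take t).drop s
  refine le_trans ?_ (hΦ u hune huc (by omega))
  refine Finset.card_le_card_of_injOn (fun y => (g.take s).foldl (fun w d => μ d w) y) ?_ ?_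
  · intro y hy
    rw [Finset.mem_coe, Finset.mem_filter] at hy
    rw [Finset.mem_coe, Finset.mem_filter]
    refine ⟨Finset.mem_univ _, ?_⟩
    have h := hy.2
    rw [hsplit, List.foldl_append] at h
    exact h.symm
  · intro y _ y' _ hyy'
    exact foldl_perm_injective μ _ hyy'

/-- `card_coincidence_le` for an unordered pair of distinct indices `s ≠ t`, both `≤ a`. -/
theorem card_coincidence_le_of_ne (μ : Fin 3 → Equiv.Perm (Fin n)) {a s t : ℕ} (Φ₀ : ℕ)
    (hΦ : ∀ w : List (Fin 3), w ≠ [] → List.IsChain (· ≠ ·) w → w.length ≤ a →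
      ((Finset.univ : Finset (Fin n)).filter (fun y => w.foldl (fun v b => μ b v) y = y)).card ≤ Φ₀)
    (g : List (Fin 3)) (hl : g.length = a) (hg : List.IsChain (· ≠ ·) g) (hst : s ≠ t) (hsa : s ≤ a)
    (hta : t ≤ a) :
    ((Finset.univ : Finset (Fin n)).filter
      (fun y => (g.take s).foldl (fun w d => μ d w) y = (g.take t).foldl (fun w d => μ d w) y)).card ≤ Φ₀ := by
  rcases Nat.lt_or_gt_of_ne hst with hlt | hgt
  · exact card_coincidence_le μ Φ₀ hΦ g hl hg hlt hta
  · have e : (Finset.univ : Finset (Fin n)).filter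
        (fun y => (g.take s).foldl (fun w d => μ d w) y = (g.take t).foldl (fun w d => μ d w) y) =
        (Finset.univ : Finset (Fin n)).filter
        (fun y => (g.take t).foldl (fun w d => μ d w) y = (g.take s).foldl (fun w d => μ d w) y) :=
      Finset.filter_congr (fun y _ => eq_comm)
    rw [e]
    exact card_coincidence_le μ Φ₀ hΦ g hl hg hgt hsa

-- adapted from Summits/.../SnSubsetDichotomyHyperoctahedralThresholdSelfCleanDarts.lean (`card_selfUnclean_le`, siege k9)
/-- **Root-local self-clean census.**  Let every nonempty reduced word of length `≤ a` (`a ≥ 1`) have at most `Φ₀` fixed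
points, and let `S v x` (for every root `(v, x)`) consist of reduced words `β` of length `a` having two rungs `s, t ≤ a` with
a coincidence `v·β_[s] = v·β_[t]` (`s ≠ t`), or `x·β_[s] = x·β_[t]` (`s ≠ t`), or `v·β_[s] = x·β_[t]`.  Then
`∑_v ∑_x |S v x| ≤ (a+1)² · n · (3·2^a) · (Φ₀+1)`: the three coincidence families, indexed by `(s, t)`, have word-fibres of
size `≤ Φ₀·n`, `≤ n·Φ₀`, `≤ n`, and there are `3·2^(a-1)` words. -/
theorem sum_sum_card_le (μ : Fin 3 → Equiv.Perm (Fin n)) {a Φ₀ : ℕ} (ha : 1 ≤ a)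
    (hΦ : ∀ w : List (Fin 3), w ≠ [] → List.IsChain (· ≠ ·) w → w.length ≤ a →
      ((Finset.univ : Finset (Fin n)).filter (fun y => w.foldl (fun v b => μ b v) y = y)).card ≤ Φ₀)
    (S : Fin n → Fin n → Finset (List (Fin 3)))
    (hS : ∀ v x, ∀ β ∈ S v x, β.length = a ∧ List.IsChain (· ≠ ·) β ∧ ∃ s ≤ a, ∃ t ≤ a,
      (s ≠ t ∧ (β.take s).foldl (fun w d => μ d w) v = (β.take t).foldl (fun w d => μ d w) v) ∨
      (s ≠ t ∧ (β.take s).foldl (fun w d => μ d w) x = (β.take t).foldl (fun w d => μ d w) x) ∨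
      (β.take s).foldl (fun w d => μ d w) v = (β.take t).foldl (fun w d => μ d w) x) :
    ∑ v : Fin n, ∑ x : Fin n, (S v x).card ≤ (a + 1) ^ 2 * n * (3 * 2 ^ a) * (Φ₀ + 1) := by
  classical
  set W := TwinSupplyCS.RW a with hWdef
  have hWcard : W.card = 3 * 2 ^ (a - 1) := TwinSupplyCS.card_RW ha
  have memW : ∀ g ∈ W, g.length = a ∧ List.IsChain (· ≠ ·) g := fun g hg => TwinSupplyCS.mem_RW.1 hg
  set D := ((univ : Finset (Fin n)) ×ˢ (univ : Finset (Fin n))) ×ˢ W with hD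
  -- the three coincidence families, indexed by ordered pairs `(s, t)`
  set Avv : ℕ × ℕ → Finset ((Fin n × Fin n) × List (Fin 3)) := fun st => D.filter
    (fun p : (Fin n × Fin n) × List (Fin 3) => st.1 ≠ st.2 ∧
      (p.2.take st.1).foldl (fun w d => μ d w) p.1.1 = (p.2.take st.2).foldl (fun w d => μ d w) p.1.1) with hAvv
  set Axx : ℕ × ℕ → Finset ((Fin n × Fin n) × List (Fin 3)) := fun st => D.filter
    (fun p : (Fin n × Fin n) × List (Fin 3) => st.1 ≠ st.2 ∧
      (p.2.take st.1).foldl (fun w d => μ d w) p.1.2 = (p.2.take st.2).foldl (fun w d => μ d w) p.1.2) with hAxx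
  set Avx : ℕ × ℕ → Finset ((Fin n × Fin n) × List (Fin 3)) := fun st => D.filter
    (fun p : (Fin n × Fin n) × List (Fin 3) =>
      (p.2.take st.1).foldl (fun w d => μ d w) p.1.1 = (p.2.take st.2).foldl (fun w d => μ d w) p.1.2) with hAvx
  -- fibrewise bound: a family cut out of `D` by a condition whose word-fibres have `≤ M` roots has `≤ |W| · M` members
  have fib : ∀ (P : (Fin n × Fin n) × List (Fin 3) → Prop) [DecidablePred P] (M : ℕ),
      (∀ g ∈ W, (((univ : Finset (Fin n)) ×ˢ (univ : Finset (Fin n))).filter (fun vx => P (vx, g))).card ≤ M) →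
      (D.filter P).card ≤ W.card * M := by
    intro P _ M hP
    have hmaps : Set.MapsTo (Prod.snd : (Fin n × Fin n) × List (Fin 3) → List (Fin 3)) ↑(D.filter P) ↑W := by
      intro p hp
      rw [Finset.mem_coe, Finset.mem_filter, hD, Finset.mem_product] at hp
      exact Finset.mem_coe.2 hp.1.2
    rw [Finset.card_eq_sum_card_fiberwise hmaps]
    calc ∑ g ∈ W, ((D.filter P).filter (fun p => p.2 = g)).card
        ≤ ∑ _g ∈ W, M := by
          refine Finset.sum_le_sum (fun g hg => ?_)
          refine le_trans ?_ (hP g hg)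
          refine Finset.card_le_card_of_injOn Prod.fst ?_ ?_
          · intro p hp
            rw [Finset.mem_coe, Finset.mem_filter, Finset.mem_filter] at hp
            rw [Finset.mem_coe, Finset.mem_filter]
            refine ⟨Finset.mem_product.2 ⟨Finset.mem_univ _, Finset.mem_univ _⟩, ?_⟩
            rw [← hp.2]
            exact hp.1.2
          · intro p hp q hq hpq
            rw [Finset.mem_coe, Finset.mem_filter] at hp hq
            exact Prod.ext hpq (hp.2.trans hq.2.symm)
      _ = W.card * M := by rw [Finset.sum_const, smul_eq_mul]
  -- the three families are small
  have hAvv_le : ∀ st ∈ range (a + 1) ×ˢ range (a + 1), (Avv st).card ≤ W.card * (Φ₀ * n) := by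
    intro st hst
    rw [Finset.mem_product, Finset.mem_range, Finset.mem_range] at hst
    refine fib _ _ (fun g hg => ?_)
    obtain ⟨hl, hc⟩ := memW g hg
    by_cases hne : st.1 = st.2
    · rw [Finset.filter_false_of_mem (fun vx _ h => h.1 hne), Finset.card_empty]
      exact Nat.zero_le _
    · calc (((univ : Finset (Fin n)) ×ˢ (univ : Finset (Fin n))).filter (fun vx : Fin n × Fin n => st.1 ≠ st.2 ∧
            (g.take st.1).foldl (fun w d => μ d w) vx.1 = (g.take st.2).foldl (fun w d => μ d w) vx.1)).card
          ≤ (((univ : Finset (Fin n)).filter (fun y => (g.take st.1).foldl (fun w d => μ d w) y =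
              (g.take st.2).foldl (fun w d => μ d w) y)) ×ˢ (univ : Finset (Fin n))).card := by
            refine Finset.card_le_card (fun vx h => ?_)
            rw [Finset.mem_filter] at h
            exact Finset.mem_product.2 ⟨Finset.mem_filter.2 ⟨Finset.mem_univ _, h.2.2⟩, Finset.mem_univ _⟩
        _ ≤ Φ₀ * n := by
            rw [Finset.card_product, Finset.card_univ, Fintype.card_fin]
            exact Nat.mul_le_mul_right _ (card_coincidence_le_of_ne μ Φ₀ hΦ g hl hc hne (by omega) (by omega))
  have hAxx_le : ∀ st ∈ range (a + 1) ×ˢ range (a + 1), (Axx st).card ≤ W.card * (n * Φ₀) := by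
    intro st hst
    rw [Finset.mem_product, Finset.mem_range, Finset.mem_range] at hst
    refine fib _ _ (fun g hg => ?_)
    obtain ⟨hl, hc⟩ := memW g hg
    by_cases hne : st.1 = st.2
    · rw [Finset.filter_false_of_mem (fun vx _ h => h.1 hne), Finset.card_empty]
      exact Nat.zero_le _
    · calc (((univ : Finset (Fin n)) ×ˢ (univ : Finset (Fin n))).filter (fun vx : Fin n × Fin n => st.1 ≠ st.2 ∧
            (g.take st.1).foldl (fun w d => μ d w) vx.2 = (g.take st.2).foldl (fun w d => μ d w) vx.2)).card
          ≤ ((univ : Finset (Fin n)) ×ˢ ((univ : Finset (Fin n)).filter (fun y =>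
              (g.take st.1).foldl (fun w d => μ d w) y = (g.take st.2).foldl (fun w d => μ d w) y))).card := by
            refine Finset.card_le_card (fun vx h => ?_)
            rw [Finset.mem_filter] at h
            exact Finset.mem_product.2 ⟨Finset.mem_univ _, Finset.mem_filter.2 ⟨Finset.mem_univ _, h.2.2⟩⟩
        _ ≤ n * Φ₀ := by
            rw [Finset.card_product, Finset.card_univ, Fintype.card_fin]
            exact Nat.mul_le_mul_left _ (card_coincidence_le_of_ne μ Φ₀ hΦ g hl hc hne (by omega) (by omega))
  have hAvx_le : ∀ st ∈ range (a + 1) ×ˢ range (a + 1), (Avx st).card ≤ W.card * n := by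
    intro st _
    refine fib _ _ (fun g _ => ?_)
    have h := Finset.card_le_card_of_injOn (s := ((univ : Finset (Fin n)) ×ˢ (univ : Finset (Fin n))).filter
        (fun vx : Fin n × Fin n => (g.take st.1).foldl (fun w d => μ d w) vx.1 =
          (g.take st.2).foldl (fun w d => μ d w) vx.2)) (t := (univ : Finset (Fin n))) Prod.fst
      (fun vx _ => Finset.mem_coe.2 (Finset.mem_univ _)) ?_
    · rwa [Finset.card_univ, Fintype.card_fin] at h
    · intro vx hvx vx' hvx' h1
      simp only [Finset.mem_coe, Finset.mem_filter, Finset.mem_product, Finset.mem_univ, true_and] at hvx hvx'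
      refine Prod.ext h1 (foldl_perm_injective μ (g.take st.2) ?_)
      change (g.take st.2).foldl (fun w d => μ d w) vx.2 = (g.take st.2).foldl (fun w d => μ d w) vx'.2
      rw [← hvx, ← hvx', h1]
  -- the double sum counts the triples `((v, x), β)` with `β ∈ S v x`
  have hsum : ∑ v : Fin n, ∑ x : Fin n, (S v x).card =
      (((univ : Finset (Fin n)) ×ˢ (univ : Finset (Fin n))).sigma (fun vx : Fin n × Fin n => S vx.1 vx.2)).card := by
    rw [Finset.card_sigma, Finset.sum_product]
  rw [hsum]
  -- cover: such a triple lies in one of the three families at some `(s, t)`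
  have hcover : Set.MapsTo (fun p : (Σ _ : Fin n × Fin n, List (Fin 3)) => ((p.1, p.2) : (Fin n × Fin n) × List (Fin 3)))
      ↑(((univ : Finset (Fin n)) ×ˢ (univ : Finset (Fin n))).sigma (fun vx : Fin n × Fin n => S vx.1 vx.2))
      ↑((range (a + 1) ×ˢ range (a + 1)).biUnion (fun st => Avv st ∪ Axx st ∪ Avx st)) := by
    intro p hp
    rw [Finset.mem_coe, Finset.mem_sigma] at hp
    obtain ⟨hl, hc, s, hs, t, ht, h⟩ := hS p.1.1 p.1.2 p.2 hp.2
    have hpD : ((p.1, p.2) : (Fin n × Fin n) × List (Fin 3)) ∈ D :=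
      Finset.mem_product.2 ⟨Finset.mem_product.2 ⟨Finset.mem_univ _, Finset.mem_univ _⟩,
        TwinSupplyCS.mem_RW.2 ⟨hl, hc⟩⟩
    have hst : (s, t) ∈ range (a + 1) ×ˢ range (a + 1) :=
      Finset.mem_product.2 ⟨Finset.mem_range.2 (Nat.lt_succ_of_le hs), Finset.mem_range.2 (Nat.lt_succ_of_le ht)⟩
    rw [Finset.mem_coe, Finset.mem_biUnion]
    rcases h with ⟨hne, e⟩ | ⟨hne, e⟩ | e
    · exact ⟨(s, t), hst, Finset.mem_union_left _ (Finset.mem_union_left _ (Finset.mem_filter.2 ⟨hpD, hne, e⟩))⟩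
    · exact ⟨(s, t), hst, Finset.mem_union_left _ (Finset.mem_union_right _ (Finset.mem_filter.2 ⟨hpD, hne, e⟩))⟩
    · exact ⟨(s, t), hst, Finset.mem_union_right _ (Finset.mem_filter.2 ⟨hpD, e⟩)⟩
  have hinj : Set.InjOn (fun p : (Σ _ : Fin n × Fin n, List (Fin 3)) => ((p.1, p.2) : (Fin n × Fin n) × List (Fin 3)))
      ↑(((univ : Finset (Fin n)) ×ˢ (univ : Finset (Fin n))).sigma (fun vx : Fin n × Fin n => S vx.1 vx.2)) := by
    rintro ⟨vx, β⟩ - ⟨vx', β'⟩ - h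
    simp only [Prod.mk.injEq] at h
    obtain ⟨rfl, rfl⟩ := h
    rfl
  refine (Finset.card_le_card_of_injOn _ hcover hinj).trans (Finset.card_biUnion_le.trans ?_)
  have hterm : ∀ st ∈ range (a + 1) ×ˢ range (a + 1),
      (Avv st ∪ Axx st ∪ Avx st).card ≤ W.card * (2 * n * (Φ₀ + 1)) := by
    intro st hst
    calc (Avv st ∪ Axx st ∪ Avx st).card ≤ (Avv st ∪ Axx st).card + (Avx st).card := Finset.card_union_le _ _
      _ ≤ (Avv st).card + (Axx st).card + (Avx st).card := Nat.add_le_add_right (Finset.card_union_le _ _) _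
      _ ≤ W.card * (Φ₀ * n) + W.card * (n * Φ₀) + W.card * n :=
          Nat.add_le_add (Nat.add_le_add (hAvv_le st hst) (hAxx_le st hst)) (hAvx_le st hst)
      _ ≤ W.card * (Φ₀ * n) + W.card * (n * Φ₀) + W.card * n + W.card * n := Nat.le_add_right _ _
      _ = W.card * (2 * n * (Φ₀ + 1)) := by ring
  refine (Finset.sum_le_sum hterm).trans ?_
  rw [Finset.sum_const, Finset.card_product, Finset.card_range, smul_eq_mul, hWcard]
  have h2 : 2 ^ a = 2 ^ (a - 1) * 2 := by rw [← pow_succ, Nat.sub_add_cancel ha]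
  rw [h2]
  exact le_of_eq (by ring)

end RootSelfCleanSum

/-- **Registered form** (`stub_rootSelfCleanSum`, STUB-PLAN target T2, a `--supports` sub-goal of crux
`stmt-MatrixMultiplication-10883` for the line `stub_poorRigidCore`): if every nonempty reduced word of length `≤ a` (`a ≥ 1`)
has at most `Φ₀` fixed points, then summed over all `n²` ordered roots `(v, x)` the reduced words `β` of length `a` that are
NOT self-clean from `(v, x)` number at most `(a+1)² · n · (3·2^a) · (Φ₀+1)` (`RootSelfCleanSum.sum_sum_card_le`: a failing
rung pair is one of four coincidences).  Fixed-point-freeness and involutivity of the colours are not used. -/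
theorem stub_rootSelfCleanSum : ∀ (n a Φ₀ : ℕ) (μ : Fin 3 → Equiv.Perm (Fin n)), (∀ b, μ b * μ b = 1) → (∀ b w, μ b w ≠ w) → 1 ≤ a → (∀ w : List (Fin 3), w ≠ [] → List.IsChain (· ≠ ·) w → w.length ≤ a → ((Finset.univ : Finset (Fin n)).filter (fun y => w.foldl (fun v b => μ b v) y = y)).card ≤ Φ₀) → ∑ v : Fin n, ∑ x : Fin n, (((Finset.univ : Finset (List.Vector (Fin 3) a)).image List.Vector.toList).filter (fun β => List.IsChain (· ≠ ·) β ∧ ¬ (∀ s ≤ a, ∀ t ≤ a, ((((β.take s).foldl (fun w d => μ d w) v) = ((β.take t).foldl (fun w d => μ d w) v) ∧ ((β.take s).foldl (fun w d => μ d w) x) = ((β.take t).foldl (fun w d => μ d w) x)) ∨ (((β.take s).foldl (fun w d => μ d w) v) = ((β.take t).foldl (fun w d => μ d w) x) ∧ ((β.take s).foldl (fun w d => μ d w) x) = ((β.take t).foldl (fun w d => μ d w) v)) ∨ (((β.take s).foldl (fun w d => μ d w) v) ≠ ((β.take t).foldl (fun w d => μ d w) v) ∧ ((β.take s).foldl (fun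 w d => μ d w) v) ≠ ((β.take t).foldl (fun w d => μ d w) x) ∧ ((β.take s).foldl (fun w d => μ d w) x) ≠ ((β.take t).foldl (fun w d => μ d w) v) ∧ ((β.take s).foldl (fun w d => μ d w) x) ≠ ((β.take t).foldl (fun w d => μ d w) x)))))).card ≤ (a + 1) ^ 2 * n * (3 * 2 ^ a) * (Φ₀ + 1) := by
  intro n a Φ₀ μ _ _ ha hΦ
  refine RootSelfCleanSum.sum_sum_card_le μ ha hΦ _ (fun v x β hβ => ?_)
  rw [Finset.mem_filter, Finset.mem_image] at hβ
  obtain ⟨⟨ω, -, hω⟩, hc, hb⟩ := hβ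
  refine ⟨by rw [← hω]; exact ω.toList_length, hc, ?_⟩
  push Not at hb
  obtain ⟨s, hs, t, ht, h1, h2, h3⟩ := hb
  by_cases e1 : (β.take s).foldl (fun w d => μ d w) v = (β.take t).foldl (fun w d => μ d w) v
  · refine ⟨s, hs, t, ht, Or.inl ⟨?_, e1⟩⟩
    rintro rfl
    exact h1 rfl rfl
  by_cases e2 : (β.take s).foldl (fun w d => μ d w) x = (β.take t).foldl (fun w d => μ d w) x
  · refine ⟨s, hs, t, ht, Or.inr (Or.inl ⟨?_, e2⟩)⟩
    rintro rfl
    exact e1 rfl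
  by_cases e3 : (β.take s).foldl (fun w d => μ d w) v = (β.take t).foldl (fun w d => μ d w) x
  · exact ⟨s, hs, t, ht, Or.inr (Or.inr e3)⟩
  by_cases e4 : (β.take s).foldl (fun w d => μ d w) x = (β.take t).foldl (fun w d => μ d w) v
  · exact ⟨t, ht, s, hs, Or.inr (Or.inr e4.symm)⟩
  exact absurd (h3 e1 e3 e4) e2

end Summit.MatrixMultiplication.MatrixMultiplication.Theorems.HyperoctahedralThreshold
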